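import Summits.BirchSwinnertonDyer.BirchSwinnertonDyer.Theorems.ManinLocalTwoThreeTowerUnitTwist
import Summits.BirchSwinnertonDyer.Rank1Residual.ManinAdditive.TowerUnitTwist

/-!
# The tower reduction with ONE auxiliary prime: E-es-66 / E-es-66₂ AT A DATUM `D` ⟸ the unipotent tower-generation law
# E-an-137 at `(D.f, q)` for a SINGLE odd prime `q ∤ N` with `p ∤ (q-1)/2` — the form the cell's census tests
# (HOME/an/g29/TOWER-an-g29-p{2,3}.txt: `q = 5` at `p = 3`, `q = 3, 7` at `p = 2`; MEMO-an §71.4–71.6)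

Summit `BirchSwinnertonDyer`, route `ManinLocalTwoThree` (cell bsd-f2-manin, analytic lens g29), cruxes C3 `ManinPrimeToThreeAtNine`
(stmt-BirchSwinnertonDyer-22968, input `h66`) / C2 `ManinOddAtFour` (stmt-…-22967, input `h66₂`).  The typed laws E-an-135
`KatoCurve.TowerUnitTwist p` and E-an-137 `UnipotentTowerGeneration p q N` quantify over ALL admissible primes `q`; the reduction to
E-es-66/66₂ (`…TowerReduction`, typer's `threeAdicWitness_of_towerUnitTwist`) and the Fourier descent (`…TowerUnitTwist`) use only ONE.
This file records the sharp per-datum statements, modularity-free (additivity at `p` from `p² ∣ N` by the typer's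
`KatoCurve.additive_of_sq_dvd_level`):

* `threeAdicPolarWitness_of_towerGeneration_at` — `W` elliptic, `D` a datum at level `N`, `9 ∣ N`, `PlusIndexPrimeTo 3 D.f`, `q` an odd
  prime `≠ 3`, `q ∤ N`, `3 ∤ (q-1)/2`, and E-an-137(3) at `(D.f, q)` from every starting level (by value) ⟹
  `ThreeAdicPolarWitness W W D.f` (E-es-66's conclusion at `D`).
* `twoAdicPolarWitness_of_towerGeneration_at` — the `p = 2` twin (`4 ∣ N`, `PlusIndexPrimeTo 2 D.f`, `2 ∤ (q-1)/2`, E-an-137(2) at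
  `(D.f, q)`) ⟹ `TwoAdicPolarWitness W W D.f`.

So the open input of the C3/C2 tower road at a given optimal class is ONE statement about ONE `q`-tower of cusps of `X₁(N)` in the
`f`-direction.  HONEST FRAMING: E-an-137 remains a LAW; C2/C3, Manin's conjecture and BSD are NOT proved by this.  Pure composition; no
definitions.
-/

set_option linter.dupNamespace false
set_option autoImplicit false

noncomputable section

open scoped Classical MatrixGroups ModularForm ComplexConjugate

open CongruenceSubgroup Complex WeierstrassCurve Literature.NumberTheory.EllipticCurves
  Literature.NumberTheory.EllipticCurves.ModularForms
  Summit.BirchSwinnertonDyer.Rank1Residual.ManinAdditive.KatoCurve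

namespace Summit.BirchSwinnertonDyer.BirchSwinnertonDyer.Theorems.ManinLocalTwoThree

variable (W : WeierstrassCurve ℚ) [W.IsElliptic] {N : ℕ} [NeZero N] (D : ModularParametrizationData W N)

/-- **E-es-66 at the datum `D` from E-an-137(3) at ONE auxiliary prime** (modularity-free): `9 ∣ N`, plus index prime to `3`, `q` an
odd prime `≠ 3` with `q ∤ N`, `3 ∤ (q-1)/2` (e.g. `q ≡ 2 (mod 3)`), and the `q`-tower differences of `D.f` generating `Λ₁(D.f)` up to
prime-to-`3` index from every starting level ⟹ the `3`-adic even polar unit witness against `Ω(W)`. -/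
theorem threeAdicPolarWitness_of_towerGeneration_at (h9 : 3 ^ 2 ∣ N) (hplus : PlusIndexPrimeTo 3 D.f)
    {q : ℕ} [Fact q.Prime] (hq2 : q ≠ 2) (hq3 : q ≠ 3) (hqN : ¬ q ∣ N) (h3q : ¬ 3 ∣ (q - 1) / 2)
    (hgen : ∀ (n₁ : ℕ), ∀ y ∈ periodLatticeGamma1 D.f, ∃ k : ℕ, ¬ 3 ∣ k ∧ (k : ℂ) * y ∈ AddSubgroup.closure
      (⋃ (n : ℕ) (_ : n₁ ≤ n) (_ : 1 ≤ n), {z : ℂ | ∃ b t : ℤ, ¬ (q : ℤ) ∣ b ∧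
        z = modularSymbol D.f (((b + t * (q : ℤ) ^ (n - 1) : ℤ) : ℚ) / (q : ℚ) ^ n) -
            modularSymbol D.f ((b : ℚ) / (q : ℚ) ^ n)})) :
    ThreeAdicPolarWitness W W D.f := by
  have hq : q.Prime := Fact.out
  have hqodd : q % 2 = 1 := hq.eq_two_or_odd.resolve_left hq2
  obtain ⟨n, hn, χ, hprim, heven, r, hr, hunit⟩ := exists_unitTwistAt_of_towerGeneration D.isNewformOf Nat.prime_three hplus
    hq2 hq3 hqN h3q hgen (padicValNat q (9 ^ (q - 1) - 1) + 1)
  haveI : NeZero (q ^ n) := ⟨pow_ne_zero _ hq.ne_zero⟩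
  have hn1 : 1 ≤ n := le_trans (Nat.le_add_left 1 _) hn
  -- LEMMA W at `x = 9`
  have hq9 : ¬ q ∣ 9 := fun h =>
    hq3 ((Nat.prime_dvd_prime_iff_eq hq Nat.prime_three).mp (hq.dvd_of_dvd_pow (show q ∣ 3 ^ 2 from h)))
  have h9χ : χ ((9 : ℕ) : ZMod (q ^ n)) ≠ 1 :=
    wieferichLevel q 9 n hq hq2 (by norm_num) hq9 (Nat.lt_of_succ_le hn) χ hprim
  have hχ3sq : χ (3 : ZMod (q ^ n)) ^ 2 ≠ 1 := by
    rw [← map_pow]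
    convert h9χ using 2
    push_cast
    norm_num
  have hχ3 : χ (3 : ZMod (q ^ n)) ≠ 1 := fun h => hχ3sq (by rw [h, one_pow])
  have hχ3' : χ (3 : ZMod (q ^ n)) ≠ -1 := fun h => hχ3sq (by rw [h, neg_one_sq])
  have hχne : χ ≠ 1 := by
    rintro rfl
    rw [DirichletCharacter.isPrimitive_def, DirichletCharacter.conductor_one] at hprim
    have : 1 < q ^ n := Nat.one_lt_pow (by omega) hq.one_lt
    omega
  have hordχ : orderOf χ ∣ q ^ (n - 1) * (q - 1) := by
    have h := orderOf_dirichletCharacter_dvd_totient χ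
    rwa [Nat.totient_prime_pow hq hn1] at h
  have h3ord : ¬ 3 ∣ orderOf χ := by
    intro h3
    rcases (Nat.Prime.dvd_mul Nat.prime_three).mp (h3.trans hordχ) with h | h
    · exact hq3 ((Nat.prime_dvd_prime_iff_eq Nat.prime_three hq).mp
        (Nat.prime_three.dvd_of_dvd_pow h)).symm
    · omega
  have hcop : (q ^ n).Coprime (3 * N) := by
    apply Nat.Coprime.pow_left
    rw [Nat.coprime_mul_iff_right]
    exact ⟨(Nat.coprime_primes hq Nat.prime_three).mpr hq3, (hq.coprime_iff_not_dvd).mpr hqN⟩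
  haveI : Fact (Nat.Prime 3) := ⟨Nat.prime_three⟩
  have hadd := additive_of_sq_dvd_level 3 W D.f D.isNewformOf h9
  refine ⟨q ^ n, inferInstance, χ, r, 1, D.isNewformOf, hadd.1, hadd.2, hcop, hprim, hχne, h3ord,
    hχ3, hχ3', heven, by simp, hr, fun s hs => ?_⟩
  simpa using hunit s hs

/-- **E-es-66₂ at the datum `D` from E-an-137(2) at ONE auxiliary prime** (modularity-free): `4 ∣ N`, plus index odd, `q` a prime with
`q ≡ 3 (mod 4)` (`2 ∤ (q-1)/2`), `q ∤ N`, and the `q`-tower differences of `D.f` generating `Λ₁(D.f)` up to odd index from every starting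
level ⟹ the `2`-adic polar unit witness against `Ω(W)`. -/
theorem twoAdicPolarWitness_of_towerGeneration_at (h4 : 2 ^ 2 ∣ N) (hplus : PlusIndexPrimeTo 2 D.f)
    {q : ℕ} [Fact q.Prime] (hq2 : q ≠ 2) (hqN : ¬ q ∣ N) (h2q : ¬ 2 ∣ (q - 1) / 2)
    (hgen : ∀ (n₁ : ℕ), ∀ y ∈ periodLatticeGamma1 D.f, ∃ k : ℕ, ¬ 2 ∣ k ∧ (k : ℂ) * y ∈ AddSubgroup.closure
      (⋃ (n : ℕ) (_ : n₁ ≤ n) (_ : 1 ≤ n), {z : ℂ | ∃ b t : ℤ, ¬ (q : ℤ) ∣ b ∧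
        z = modularSymbol D.f (((b + t * (q : ℤ) ^ (n - 1) : ℤ) : ℚ) / (q : ℚ) ^ n) -
            modularSymbol D.f ((b : ℚ) / (q : ℚ) ^ n)})) :
    TwoAdicPolarWitness W W D.f := by
  have hq : q.Prime := Fact.out
  have hq3 : 3 ≤ q := by
    rcases hq.eq_two_or_odd' with h | h
    · exact absurd h hq2
    · have := hq.two_le; rcases h with ⟨k, hk⟩; omega
  obtain ⟨n, hn, χ, hprim, heven, r, hr, hunit⟩ := exists_unitTwistAt_of_towerGeneration D.isNewformOf Nat.prime_two hplus
    hq2 hq2 hqN h2q hgen (padicValNat q (8 ^ (q - 1) - 1) + 1)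
  haveI : NeZero (q ^ n) := ⟨pow_ne_zero _ hq.ne_zero⟩
  have hn1 : 1 ≤ n := le_trans (Nat.le_add_left 1 _) hn
  -- LEMMA W at `x = 8`
  have hq8 : ¬ q ∣ 8 := fun h =>
    hq2 ((Nat.prime_dvd_prime_iff_eq hq Nat.prime_two).mp (hq.dvd_of_dvd_pow (show q ∣ 2 ^ 3 from h)))
  have h8χ : χ ((8 : ℕ) : ZMod (q ^ n)) ≠ 1 :=
    wieferichLevel q 8 n hq hq2 (by norm_num) hq8 (Nat.lt_of_succ_le hn) χ hprim
  have hχ8 : χ (8 : ZMod (q ^ n)) ≠ 1 := by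
    convert h8χ using 2
    push_cast
    rfl
  have hχne : χ ≠ 1 := by
    rintro rfl
    rw [DirichletCharacter.isPrimitive_def, DirichletCharacter.conductor_one] at hprim
    have : 1 < q ^ n := Nat.one_lt_pow (by omega) hq.one_lt
    omega
  have h2ord : ¬ 2 ∣ orderOf χ := by
    intro h2
    have hM := orderOf_dvd_of_pow_eq_one (pow_half_totient_eq_one_of_even hq hq2 hn1 heven)
    rcases (Nat.Prime.dvd_mul Nat.prime_two).mp (h2.trans hM) with h | h
    · exact hq2 ((Nat.prime_dvd_prime_iff_eq Nat.prime_two hq).mp (Nat.prime_two.dvd_of_dvd_pow h)).symm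
    · exact h2q h
  have hcop : (q ^ n).Coprime (2 * N) := by
    apply Nat.Coprime.pow_left
    rw [Nat.coprime_mul_iff_right]
    exact ⟨(Nat.coprime_primes hq Nat.prime_two).mpr hq2, (hq.coprime_iff_not_dvd).mpr hqN⟩
  haveI : Fact (Nat.Prime 2) := ⟨Nat.prime_two⟩
  have hadd := additive_of_sq_dvd_level 2 W D.f D.isNewformOf h4
  refine ⟨q ^ n, inferInstance, χ, r, 1, D.isNewformOf, hadd.1, hadd.2, hcop, hprim, hχne, h2ord,
    hχ8, by simp, hr, fun s hs => ?_⟩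
  simpa using hunit s hs

end Summit.BirchSwinnertonDyer.BirchSwinnertonDyer.Theorems.ManinLocalTwoThree

end
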